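import Mathlib
import Summits.Ventures.PercRepro2.CoinChainXAGateBridge
import Summits.Ventures.PercRepro2.CoinChainXAGMFact
import Summits.Ventures.PercRepro2.CoinChainXAGR1Fact

/-!
# The IDENTITY gate `d' = d` of (XA′) is a theorem of the chain — the world-1 covariance about the world-0 means
(blind cell PercRepro2, night-2 g34; proofs/NIGHT2-DARC.md §74)

For `ent = {m}`, ANY `ent' ∋ j, j'`, the entry markers `x = 1[j ∈ ·]`, `y = 1[j' ∈ ·]` and the OPEN gate `d' = d`
(the corner pair (full, m) of the corner-pair table, the top up-set of the gate lattice), the cleared (XA′) reads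
`0 ≤ L·Σ_W R¹(W)·(L·x(W) − Px)·(L·y(W) − Py)` — the world-1 law's covariance of the two markers about the
world-0 means (the `Cross` term vanishes, `G⁰ = R⁰`).  In the twelve parts (`cg_identity_parts`), with
`L = a + δ + u + t`, `R = a + u + t`, `Px = XJ + XU + XM`, `Py = YJ + YU + YM`, the surviving shifts
`Sx = L·(XU + XM) − Px·R`, `Sy = L·(YU + YM) − Py·R` and the slacks `GM = L·(XYU + XYM) − Py·(XU + XM)`,
`GMp = L·(XYU + XYM) − Px·(YU + YM)`, `GR1 = R·(XYU + XYM) − (XU + XM)·(YU + YM)` of the three whole-lattice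
Ahlswede–Daykin facts `cg_fact_GM`, its mirror and `cg_fact_GR1`, the target is EXACTLY

  `T = L·(L·GM − Px·Sy) = L·(L·GMp − Py·Sx)`,   with   `R·(L·GM − Px·Sy) = L²·GR1 + Sx·Sy`

(three ring identities), so `T ≥ 0` when `Sy ≤ 0` (first form), when `Sx ≤ 0` (second form), and when
`Sx, Sy > 0` (then `R·(L·GM − Px·Sy) > 0`, hence `R > 0` and the bracket is positive): «the world-1 covariance
dominates the product of the world shifts».  No case split on the sign of `D`, no Handelman certificate: the
corner pair (full, m) — infeasible at degree 4 in its cases A and E on the 45-fact family (§73.9b) — needs the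
multiplier `R`, which the identity supplies.  `chain_XA'_identity_gate` is the chain theorem through the
general-gate bridge `chain_XA'_gate_of_parts` (the gate sums are literally the parts).
-/

namespace Summit.Ventures.PercRepro2.Coin

open Classical

section IdentityGateParts

variable {R : Type*} [Field R] [LinearOrder R] [IsStrictOrderedRing R]

set_option maxHeartbeats 1600000 in
/-- **THE IDENTITY GATE IN THE PARTS**: `0 ≤ T` from the three whole-lattice facts `GM`, `GMp`, `GR1` and the
nonnegativity of the parts, by the identities `T = L·(L·GM − Px·Sy) = L·(L·GMp − Py·Sx)` and
`R·(L·GM − Px·Sy) = L²·GR1 + Sx·Sy`. -/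
theorem cg_identity_parts (a δ u t XJ XU XM YJ YU YM XYU XYM : R)
    (ha : 0 ≤ a) (hδ : 0 ≤ δ) (hu : 0 ≤ u) (ht : 0 ≤ t)
    (hXJ : 0 ≤ XJ) (hXU : 0 ≤ XU) (hXM : 0 ≤ XM) (hYJ : 0 ≤ YJ) (hYU : 0 ≤ YU) (hYM : 0 ≤ YM)
    (hGM : (XU + XM) * (YJ + YU + YM) ≤ (a + δ + u + t) * (XYU + XYM))
    (hGMp : (YU + YM) * (XJ + XU + XM) ≤ (a + δ + u + t) * (XYU + XYM))
    (hGR1 : (XU + XM) * (YU + YM) ≤ (a + u + t) * (XYU + XYM)) :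
    0 ≤ (a + δ + u + t) * ((a + δ + u + t) * (a + δ + u + t) * (XYU + XYM) - (a + δ + u + t) * (YJ + YU + YM) * (XU + XM) - (a + δ + u + t) * (XJ + XU + XM) * (YU + YM) + (XJ + XU + XM) * (YJ + YU + YM) * (a + u + t)) - (((a + δ + u + t) * (XU + XM) - (XJ + XU + XM) * (a + u + t)) * ((a + δ + u + t) * (YJ + YU + YM) - (YJ + YU + YM) * (a + δ + u + t)) + ((a + δ + u + t) * (YU + YM) - (YJ + YU + YM) * (a + u + t)) * ((a + δ + u + t) * (XJ + XU + XM) - (XJ + XU + XM) * (a + δ + u + t))) := by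
  set L := a + δ + u + t with hL_def
  set Rm := a + u + t with hRm_def
  set Px := XJ + XU + XM with hPx_def
  set Py := YJ + YU + YM with hPy_def
  set Sx := L * (XU + XM) - Px * Rm with hSx_def
  set Sy := L * (YU + YM) - Py * Rm with hSy_def
  set GM := L * (XYU + XYM) - Py * (XU + XM) with hGM_def
  set GMp := L * (XYU + XYM) - Px * (YU + YM) with hGMp_def
  set GR1 := Rm * (XYU + XYM) - (XU + XM) * (YU + YM) with hGR1_def
  have hL : 0 ≤ L := by rw [hL_def]; linarith
  have hRm : 0 ≤ Rm := by rw [hRm_def]; linarith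
  have hPx0 : 0 ≤ Px := by rw [hPx_def]; linarith
  have hPy0 : 0 ≤ Py := by rw [hPy_def]; linarith
  have hGM0 : 0 ≤ GM := by rw [hGM_def]; linarith
  have hGMp0 : 0 ≤ GMp := by rw [hGMp_def]; linarith
  have hGR10 : 0 ≤ GR1 := by rw [hGR1_def]; linarith
  have e1 : (a + δ + u + t) * ((a + δ + u + t) * (a + δ + u + t) * (XYU + XYM) - (a + δ + u + t) * (YJ + YU + YM) * (XU + XM) - (a + δ + u + t) * (XJ + XU + XM) * (YU + YM) + (XJ + XU + XM) * (YJ + YU + YM) * (a + u + t)) - (((a + δ + u + t) * (XU + XM) - (XJ + XU + XM) * (a + u + t)) * ((a + δ + u + t) * (YJ + YU + YM) - (YJ + YU + YM) * (a + δ + u + t)) + ((a + δ + u + t) * (YU + YM) - (YJ + YU + YM) * (a + u + t)) * ((a + δ + u + t) * (XJ + XU + XM) - (XJ + XU + XM) * (a + δ + u + t))) = L * (L * GM - Px * Sy) := by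
    simp only [hGM_def, hSy_def, hL_def, hPx_def, hPy_def, hRm_def]; ring
  have e2 : L * (L * GM - Px * Sy) = L * (L * GMp - Py * Sx) := by
    simp only [hGM_def, hGMp_def, hSx_def, hSy_def, hL_def, hPx_def, hPy_def, hRm_def]; ring
  have e3 : Rm * (L * GM - Px * Sy) = L ^ 2 * GR1 + Sx * Sy := by
    simp only [hGM_def, hGR1_def, hSx_def, hSy_def, hL_def, hPx_def, hPy_def, hRm_def]; ring
  rw [e1]
  rcases le_or_gt Sy 0 with hSy | hSy
  · exact mul_nonneg hL (by linarith [mul_nonneg hL hGM0, mul_nonneg hPx0 (neg_nonneg.2 hSy)])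
  rcases le_or_gt Sx 0 with hSx | hSx
  · rw [e2]; exact mul_nonneg hL (by linarith [mul_nonneg hL hGMp0, mul_nonneg hPy0 (neg_nonneg.2 hSx)])
  have hpos : 0 < Rm * (L * GM - Px * Sy) := by
    rw [e3]; exact add_pos_of_nonneg_of_pos (mul_nonneg (sq_nonneg L) hGR10) (mul_pos hSx hSy)
  have hbr : 0 < L * GM - Px * Sy := by
    rcases lt_or_eq_of_le hRm with hR | hR
    · exact (mul_pos_iff_of_pos_left hR).mp hpos
    · rw [← hR, zero_mul] at hpos; exact absurd hpos (lt_irrefl 0)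
  exact mul_nonneg hL hbr.le

end IdentityGateParts

section IdentityGateChain

variable {V : Type*} [DecidableEq V] {R : Type*} [Field R] [LinearOrder R] [IsStrictOrderedRing R]

set_option maxHeartbeats 4000000 in
/-- **THE IDENTITY GATE `d' = d` IS A THEOREM OF THE CHAIN**: for `ent = {m}`, ANY `ent' ∋ j, j'` and the entry
markers, the cleared (XA′) at the open gate holds under the chain's standing hypotheses (no log-supermodularity of
`c`, no `hratio`): the general-gate bridge with `d' = d`, the facts `GM`, `GMp`, `GR1`, and `cg_identity_parts`. -/
theorem chain_XA'_identity_gate (U : Finset V) (m j j' : V) (ent' : Finset V) (ν c d : Finset V → R)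
    (hj : j ∈ ent') (hj' : j' ∈ ent')
    (hν0 : ∀ W, 0 ≤ ν W) (hν : ∀ s ⊆ U, ∀ t ⊆ U, ν s * ν t ≤ ν (s ∩ t) * ν (s ∪ t))
    (hc0 : ∀ W, 0 ≤ c W) (hd0 : ∀ W, 0 ≤ d W) (hdc : ∀ W, d W ≤ c W)
    (hcd : ∀ s t, c s * d t ≤ c (s ∩ t) * d (s ∪ t))
    (hdd : ∀ s t, d s * d t ≤ d (s ∩ t) * d (s ∪ t))
    (x y : Finset V → R) (hx : ∀ W, x W = if j ∈ W then 1 else 0) (hy : ∀ W, y W = if j' ∈ W then 1 else 0) :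
    (((∑ W ∈ U.powerset, ν W * chainMix {m} ent' 0 c d W) * (∑ W ∈ U.powerset, ν W * chainMix {m} ent' 1 c d W * x W) - (∑ W ∈ U.powerset, ν W * chainMix {m} ent' 0 c d W * x W) * (∑ W ∈ U.powerset, ν W * chainMix {m} ent' 1 c d W)) *
          ((∑ W ∈ U.powerset, ν W * chainMix {m} ent' 0 c d W) * (∑ W ∈ U.powerset, ν W * chainMix {m} ent' 0 c d W * y W) - (∑ W ∈ U.powerset, ν W * chainMix {m} ent' 0 c d W * y W) * (∑ W ∈ U.powerset, ν W * chainMix {m} ent' 0 c d W))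
        + ((∑ W ∈ U.powerset, ν W * chainMix {m} ent' 0 c d W) * (∑ W ∈ U.powerset, ν W * chainMix {m} ent' 1 c d W * y W) - (∑ W ∈ U.powerset, ν W * chainMix {m} ent' 0 c d W * y W) * (∑ W ∈ U.powerset, ν W * chainMix {m} ent' 1 c d W)) *
          ((∑ W ∈ U.powerset, ν W * chainMix {m} ent' 0 c d W) * (∑ W ∈ U.powerset, ν W * chainMix {m} ent' 0 c d W * x W) - (∑ W ∈ U.powerset, ν W * chainMix {m} ent' 0 c d W * x W) * (∑ W ∈ U.powerset, ν W * chainMix {m} ent' 0 c d W))) ≤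
        (∑ W ∈ U.powerset, ν W * chainMix {m} ent' 0 c d W) * ((∑ W ∈ U.powerset, ν W * chainMix {m} ent' 0 c d W) * (∑ W ∈ U.powerset, ν W * chainMix {m} ent' 0 c d W) * (∑ W ∈ U.powerset, ν W * chainMix {m} ent' 1 c d W * (x W * y W))
          - (∑ W ∈ U.powerset, ν W * chainMix {m} ent' 0 c d W) * (∑ W ∈ U.powerset, ν W * chainMix {m} ent' 0 c d W * y W) * (∑ W ∈ U.powerset, ν W * chainMix {m} ent' 1 c d W * x W)
          - (∑ W ∈ U.powerset, ν W * chainMix {m} ent' 0 c d W) * (∑ W ∈ U.powerset, ν W * chainMix {m} ent' 0 c d W * x W) * (∑ W ∈ U.powerset, ν W * chainMix {m} ent' 1 c d W * y W)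
          + (∑ W ∈ U.powerset, ν W * chainMix {m} ent' 0 c d W * x W) * (∑ W ∈ U.powerset, ν W * chainMix {m} ent' 0 c d W * y W) * (∑ W ∈ U.powerset, ν W * chainMix {m} ent' 1 c d W)) := by
  refine chain_XA'_gate_of_parts U m j j' ent' ν c d d hj hj' x y hx hy ?_
  have hx0 : ∀ W, 0 ≤ x W := fun W => by rw [hx W]; split_ifs <;> norm_num
  have hy0 : ∀ W, 0 ≤ y W := fun W => by rw [hy W]; split_ifs <;> norm_num
  have hxm : ∀ s t, x s ≤ x (s ∪ t) := fun s t => by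
    rw [hx s, hx (s ∪ t)]
    by_cases h : j ∈ s
    · rw [if_pos h, if_pos (Finset.mem_union_left t h)]
    · rw [if_neg h]; split_ifs <;> norm_num
  have hym : ∀ s t, y s ≤ y (s ∪ t) := fun s t => by
    rw [hy s, hy (s ∪ t)]
    by_cases h : j' ∈ s
    · rw [if_pos h, if_pos (Finset.mem_union_left t h)]
    · rw [if_neg h]; split_ifs <;> norm_num
  have hxI : ∀ W, (¬ ∃ r ∈ ({m} : Finset V) ∪ ent', r ∈ W) → x W = 0 := fun W hW => by
    rw [hx W]; exact if_neg (fun h => hW ⟨j, Finset.mem_union.2 (Or.inr hj), h⟩)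
  have hyI : ∀ W, (¬ ∃ r ∈ ({m} : Finset V) ∪ ent', r ∈ W) → y W = 0 := fun W hW => by
    rw [hy W]; exact if_neg (fun h => hW ⟨j', Finset.mem_union.2 (Or.inr hj'), h⟩)
  have hcd0 : ∀ W, 0 ≤ c W - d W := fun W => by linarith [hdc W]
  have FGM := cg_fact_GM U m ent' ν c d hν0 hν hc0 hd0 hdc hcd hdd x y hx0 hy0 hxm hym hxI hyI
  have FGMp := cg_fact_GM U m ent' ν c d hν0 hν hc0 hd0 hdc hcd hdd y x hy0 hx0 hym hxm hyI hxI
  have FGR1 := cg_fact_GR1 U m ent' ν c d hν0 hν hc0 hd0 hdc hcd hdd x y hx0 hy0 hxm hym hxI hyI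
  have eyx : ∑ W ∈ U.powerset.filter (fun W => ∃ r ∈ ({m} : Finset V), r ∈ W), ν W * d W * (y W * x W) =
      ∑ W ∈ U.powerset.filter (fun W => ∃ r ∈ ({m} : Finset V), r ∈ W), ν W * d W * (x W * y W) :=
    Finset.sum_congr rfl (fun W _ => by ring)
  have eyxD : ∑ W ∈ U.powerset.filter (fun W => (¬ ∃ r ∈ ({m} : Finset V), r ∈ W) ∧ ∃ r ∈ ent', r ∈ W), ν W * d W * (y W * x W) =
      ∑ W ∈ U.powerset.filter (fun W => (¬ ∃ r ∈ ({m} : Finset V), r ∈ W) ∧ ∃ r ∈ ent', r ∈ W), ν W * d W * (x W * y W) :=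
    Finset.sum_congr rfl (fun W _ => by ring)
  rw [eyxD, eyx] at FGMp
  exact cg_identity_parts _ _ _ _ _ _ _ _ _ _ _ _
    (Finset.sum_nonneg (fun W _ => mul_nonneg (hν0 W) (hc0 W)))
    (Finset.sum_nonneg (fun W _ => mul_nonneg (hν0 W) (hcd0 W)))
    (Finset.sum_nonneg (fun W _ => mul_nonneg (hν0 W) (hd0 W)))
    (Finset.sum_nonneg (fun W _ => mul_nonneg (hν0 W) (hd0 W)))
    (Finset.sum_nonneg (fun W _ => mul_nonneg (mul_nonneg (hν0 W) (hcd0 W)) (hx0 W)))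
    (Finset.sum_nonneg (fun W _ => mul_nonneg (mul_nonneg (hν0 W) (hd0 W)) (hx0 W)))
    (Finset.sum_nonneg (fun W _ => mul_nonneg (mul_nonneg (hν0 W) (hd0 W)) (hx0 W)))
    (Finset.sum_nonneg (fun W _ => mul_nonneg (mul_nonneg (hν0 W) (hcd0 W)) (hy0 W)))
    (Finset.sum_nonneg (fun W _ => mul_nonneg (mul_nonneg (hν0 W) (hd0 W)) (hy0 W)))
    (Finset.sum_nonneg (fun W _ => mul_nonneg (mul_nonneg (hν0 W) (hd0 W)) (hy0 W)))
    FGM FGMp FGR1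

end IdentityGateChain

end Summit.Ventures.PercRepro2.Coin
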